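import Summits.RiemannHypothesis.RiemannHypothesis.Theorems.SuzukiFlowPairingWeilSide

/-!
# Operator side of `FlowPairing`: the prime piece through the window (column DBR; RH-FREE)

RH-FREE throughout; nothing here bears on the truth of RH.  The prime piece of the flow kernel
(`Theorems.SuzukiFlowKernelReal.flowKernel_eq`) is `J_P(w) = Σ' n Λ(n) n^{−1/2} K_θ(w − log n)` — on every
bounded range a FINITE sum, `K_θ` being causal.  For `G = 𝖪_θ[t] f`, `f ∈ L¹(−t,t)`:

* `primePiece_eq_sum` — on `w ≤ 2|t|` the series is the finite sum over `n < N_t = ⌈e^{2|t|}⌉₊ + 1`;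
* **`integral_winOp_mul_winOp_primePiece`** —
  `∫_{(−t,t)} G(x)·(∫_{(−t,t)} J_P(x+y) f(y) dy) dx = Σ' n Λ(n) n^{−1/2} Φ(log n)`,
  `Φ(v) = ∫_{(−t,t)} G(x)G(x−v) dx` (`= (g_θ ⋆ g̃_θ)(v)` for `v ≥ 0`, pairing lemma of
  `Theorems.SuzukiFlowPairingCausality`): the prime side `Σ Λ(n)n^{−1/2} φ(log n)` of Weil's functional.

References: [Su20] M. Suzuki, ASPM 84 (2020); E. Bombieri, Rend. Lincei (9) 11 (2000), Thm 2.
-/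

noncomputable section

-- D-0017: `Summit.<S>.<S>.…` is the designed namespace of a single-problem summit.
set_option linter.dupNamespace false

open Complex MeasureTheory Set Filter Topology
open scoped Real ArithmeticFunction.vonMangoldt

namespace Summit.RiemannHypothesis.RiemannHypothesis.Theorems.SuzukiThetaFlow

open Literature.NumberTheory.LFunctions
open Summit.RiemannHypothesis.RiemannHypothesis.Theorems.SuzukiKernelSemigroup

variable {θ t : ℝ} {f : ℝ → ℝ}

/-- RH-FREE.  Beyond `N_t = ⌈e^{2|t|}⌉₊ + 1` the primes do not see the doubled window: for `n ∉ range N_t`,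
`log n ≥ 2|t|`. -/
theorem two_abs_le_log_of_not_mem_range {t : ℝ} {n : ℕ} (hn : n ∉ Finset.range (⌈Real.exp (2 * |t|)⌉₊ + 1)) :
    2 * |t| ≤ Real.log n := by
  rw [Finset.mem_range, not_lt] at hn
  have hn' : Real.exp (2 * |t|) ≤ n := (Nat.le_ceil _).trans (by exact_mod_cast Nat.le_of_succ_le hn)
  have hpos : (0 : ℝ) < n := (Real.exp_pos _).trans_le hn'
  rwa [Real.le_log_iff_exp_le hpos]

/-- RH-FREE.  **The prime piece is a finite sum on `w ≤ 2|t|`** (causality of `K_θ`). -/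
theorem primePiece_eq_sum (hθ : 1 < θ) {t w : ℝ} (hw : w ≤ 2 * |t|) :
    ∑' n : ℕ, (Λ n : ℝ) * (n : ℝ) ^ (-(1 / 2 : ℝ)) * limKernel θ (w - Real.log n) =
      ∑ n ∈ Finset.range (⌈Real.exp (2 * |t|)⌉₊ + 1), (Λ n : ℝ) * (n : ℝ) ^ (-(1 / 2 : ℝ)) * limKernel θ (w - Real.log n) := by
  refine tsum_eq_sum fun n hn => ?_
  rw [limKernel_eq_zero_of_nonpos hθ (by linarith [two_abs_le_log_of_not_mem_range hn]), mul_zero]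

/-- RH-FREE.  The window pairing `Φ(v) = ∫_{(−t,t)} G(x)G(x−v)dx` vanishes for `v ≥ 2|t|`. -/
theorem integral_winOp_mul_shift_eq_zero (hθ : 1 < θ) (f : ℝ → ℝ) {t v : ℝ} (hv : 2 * |t| ≤ v) :
    ∫ x in Ioo (-t) t, winOp (limKernel θ) t f x * winOp (limKernel θ) t f (x - v) = 0 := by
  refine setIntegral_eq_zero_of_forall_eq_zero fun x hx => ?_
  rw [winOp_limKernel_eq_zero_of_le hθ (x := x - v) (by linarith [hx.2, le_abs_self t]) f, mul_zero]

/-- RH-FREE.  The inner window integral of the (truncated) prime piece: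
`∫_{(−t,t)} J_P(x+y) f(y) dy = Σ_{n<N_t} Λ(n)n^{−1/2} G(x − log n)` for `x ≤ t`. -/
theorem winOp_primePiece (hθ : 1 < θ) (hf : IntegrableOn f (Ioo (-t) t)) {x : ℝ} (hx : x ≤ t) :
    ∫ y in Ioo (-t) t, (∑' n : ℕ, (Λ n : ℝ) * (n : ℝ) ^ (-(1 / 2 : ℝ)) * limKernel θ (x + y - Real.log n)) * f y =
      ∑ n ∈ Finset.range (⌈Real.exp (2 * |t|)⌉₊ + 1),
        (Λ n : ℝ) * (n : ℝ) ^ (-(1 / 2 : ℝ)) * winOp (limKernel θ) t f (x - Real.log n) := by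
  have hstep : ∫ y in Ioo (-t) t, (∑' n : ℕ, (Λ n : ℝ) * (n : ℝ) ^ (-(1 / 2 : ℝ)) * limKernel θ (x + y - Real.log n)) * f y =
      ∫ y in Ioo (-t) t, ∑ n ∈ Finset.range (⌈Real.exp (2 * |t|)⌉₊ + 1),
        (Λ n : ℝ) * (n : ℝ) ^ (-(1 / 2 : ℝ)) * (limKernel θ (x - Real.log n + y) * f y) := by
    refine setIntegral_congr_fun measurableSet_Ioo fun y hy => ?_
    rw [primePiece_eq_sum hθ (by linarith [hy.2, le_abs_self t]), Finset.sum_mul]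
    refine Finset.sum_congr rfl fun n _ => ?_
    rw [show x + y - Real.log n = x - Real.log n + y by ring]
    ring
  rw [hstep, integral_finsetSum]
  · refine Finset.sum_congr rfl fun n _ => ?_
    rw [integral_const_mul]
    rfl
  · intro n _
    exact (integrableOn_kernel_mul hθ hf (x - Real.log n)).const_mul _

/-- **RH-FREE · the prime piece through both window integrations**: for `θ > 1`, `f ∈ L¹(−t,t)`,
`G = 𝖪_θ[t]f` and `J_P(w) = Σ' n Λ(n)n^{−1/2}K_θ(w − log n)`,
`∫_{(−t,t)} G(x)·(∫_{(−t,t)} J_P(x+y) f(y) dy) dx = Σ' n Λ(n) n^{−1/2} ∫_{(−t,t)} G(x)G(x − log n) dx`.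
Nothing here bears on RH. -/
theorem integral_winOp_mul_winOp_primePiece (hθ : 1 < θ) (hf : IntegrableOn f (Ioo (-t) t)) :
    ∫ x in Ioo (-t) t, winOp (limKernel θ) t f x *
        ∫ y in Ioo (-t) t, (∑' n : ℕ, (Λ n : ℝ) * (n : ℝ) ^ (-(1 / 2 : ℝ)) * limKernel θ (x + y - Real.log n)) * f y =
      ∑' n : ℕ, (Λ n : ℝ) * (n : ℝ) ^ (-(1 / 2 : ℝ)) *
        ∫ x in Ioo (-t) t, winOp (limKernel θ) t f x * winOp (limKernel θ) t f (x - Real.log n) := by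
  have hGc := continuous_winOp hθ hf
  have hIa : ∀ c : ℝ, IntegrableOn (fun x ↦ winOp (limKernel θ) t f x * winOp (limKernel θ) t f (x - c))
      (Ioo (-t) t) := fun c ↦
    ((hGc.mul (hGc.comp (continuous_id.sub continuous_const))).continuousOn.integrableOn_compact
      isCompact_Icc).mono_set Ioo_subset_Icc_self
  -- truncate the outer series too
  rw [tsum_eq_sum (s := Finset.range (⌈Real.exp (2 * |t|)⌉₊ + 1)) (fun n hn => by
    rw [integral_winOp_mul_shift_eq_zero hθ f (two_abs_le_log_of_not_mem_range hn), mul_zero])]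
  have hstep : ∫ x in Ioo (-t) t, winOp (limKernel θ) t f x *
      ∫ y in Ioo (-t) t, (∑' n : ℕ, (Λ n : ℝ) * (n : ℝ) ^ (-(1 / 2 : ℝ)) * limKernel θ (x + y - Real.log n)) * f y =
      ∫ x in Ioo (-t) t, ∑ n ∈ Finset.range (⌈Real.exp (2 * |t|)⌉₊ + 1),
        (Λ n : ℝ) * (n : ℝ) ^ (-(1 / 2 : ℝ)) *
          (winOp (limKernel θ) t f x * winOp (limKernel θ) t f (x - Real.log n)) := by
    refine setIntegral_congr_fun measurableSet_Ioo fun x hx => ?_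
    rw [winOp_primePiece hθ hf hx.2.le, Finset.mul_sum]
    refine Finset.sum_congr rfl fun n _ => by ring
  rw [hstep, integral_finsetSum]
  · refine Finset.sum_congr rfl fun n _ => ?_
    rw [integral_const_mul]
  · intro n _
    exact (hIa _).const_mul _

end Summit.RiemannHypothesis.RiemannHypothesis.Theorems.SuzukiThetaFlow

end
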